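import Mathlib
import HarnessLib
import Summits.NavierStokesRegularity.NavierStokesRegularity.Theorems.PoloidalWindowDoorLrcModEntireSonicSheetTrig
import Summits.NavierStokesRegularity.NavierStokesRegularity.Theorems.PoloidalWindowDoorPoloidalWindowRigidityStructureFunctionDynamics

/-!
# Route `PoloidalWindowDoor`, item `LrcModEntire` (stmt-NavierStokesRegularity-20428), cell (Q4-curved) of the (TH) column —
# ASSEMBLY TOOLS I: the cross-web velocity form (6b) as pure algebra, weighted jets, and partial derivatives along coordinate lines

Cell ns-regularity-ideate, helper seat ns-k2-port-2 g9 (assembly owner, idea-crit-7 g12 23:21:50Z) under the LEAD of item 20428.  Memo `Cruxes/LrcModEntire/TOWER-CLOSES-port2g9.md`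
§D1 / `T2B-g17.md` §6(6b).  `--supports stmt-NavierStokesRegularity-20428 --as helper`.  CLASS-FREE.

* `crossweb_velocity_form` — PURE ALGEBRA: the speed law (`…CurvedSheetSpeedLaw(Local).curved_sheet_speed_law(_on)`:
  `J·V·a₂ = −(1−μ)(J a₃ − k a₂) + J a₂ (h − d′U₂) − 2μ_z d′ J a₂/(1−μ)`), the cubic law (`…CurvedSheetJet(Local).curved_sheet_cubic_law(_on)`:
  `J((d′²+μ)a₃ − 2d′a₂′ − d″a₂) = μ k a₂`), the ridge law `a₂ = −κ`, `a₂′ = −κ′`, and the split `V = α + β` give, for `J, κ, d′²+μ, 1−μ ≠ 0`: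
  **`h = α + g − c·k/J`** with `c = (1−μ)d′²/(d′²+μ)` and `g = β + (1−μ)(2d′κ′/κ + d″)/(d′²+μ) + d′U₂ + 2μ_z d′/(1−μ)` (functions of the height only).
* `hasDerivAt_weighted` — `HasDerivAt f (d₁·(f′/d₁)) z` (the weighted-jet convention of `…CurvedTowerElimHeight`).
* `fderiv_partial_swap` — Schwarz at a `C²` point in `fderiv` form (the slices `hasDerivAt_slice_fst/snd` are K2-p2 g17's `…SonicSheetTrig`, `differentiableAt_dirPartial` is
  `…StructureFunctionDynamics` — reused, not restated);
* `weighted_jets` (three weighted height jets of a smooth profile) and `plane_jets` (the four jets of a smooth function on an open product, Schwarz included) — the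
  inputs of `…CurvedTowerElimHeight.tower_first_integral_height`;
* `hkin_of_criticality` — the kinematic sheet-speed hypothesis `hkin` of B-SPEEDc from criticality along `ν` at a moving web point (chain rule).

WHAT THIS IS NOT: not a claim about Navier–Stokes regularity and not a stub of the registry; class-free tools for the residual research cells
`stub_Q4curvedAperiodic` / `stub_Q4sonicLineNegIsolated` of `Cruxes/LrcModEntire/Lines/twist_split.lean` (v14; items 20428 / 19708 / 27893 OPEN).
-/

noncomputable section

set_option linter.dupNamespace false
set_option linter.style.longLine false

namespace Summit.NavierStokesRegularity.NavierStokesRegularity.Theorems.PoloidalWindowDoorLrcModEntireCurvedTowerSheetForm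

open Set Function Filter Topology
open scoped ContDiff
open Summit.NavierStokesRegularity.NavierStokesRegularity.Theorems.PoloidalWindowDoorLrcModEntireSonicSheetTrig (hasDerivAt_slice_fst hasDerivAt_slice_snd)
open Summit.NavierStokesRegularity.NavierStokesRegularity.Theorems.PoloidalWindowDoorPoloidalWindowRigidityStructureFunctionDynamics (differentiableAt_dirPartial)

/-! ### The cross-web velocity form (6b), pure algebra -/

/-- ★ **(6b) as pure algebra.**  See the module docstring. -/
theorem crossweb_velocity_form {J V a₂ a₃ a₂' k μ μz d' d'' U₂ h α β κ κ' : ℝ}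
    (hJ : J ≠ 0) (hκ : κ ≠ 0) (hQ : d' ^ 2 + μ ≠ 0) (hμ : 1 - μ ≠ 0)
    (hspeed : J * V * a₂ = -((1 - μ) * (J * a₃ - k * a₂)) + J * a₂ * (h - d' * U₂) - 2 * μz * d' * J * a₂ / (1 - μ))
    (hcubic : J * ((d' ^ 2 + μ) * a₃ - 2 * d' * a₂' - d'' * a₂) = μ * k * a₂)
    (hridge : a₂ = -κ) (hridge' : a₂' = -κ') (hsplit : V = α + β) :
    h = α + (β + (1 - μ) * (2 * d' * κ' / κ + d'') / (d' ^ 2 + μ) + d' * U₂ + 2 * μz * d' / (1 - μ))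
          - ((1 - μ) * d' ^ 2 / (d' ^ 2 + μ)) * k / J := by
  subst hridge hridge' hsplit
  have ha : (-κ : ℝ) ≠ 0 := neg_ne_zero.2 hκ
  field_simp
  field_simp at hspeed
  -- eliminate `a₃` with the cubic law
  have h3 : (d' ^ 2 + μ) * a₃ = (2 * d' * -κ' + d'' * -κ) + μ * k * -κ / J := by
    field_simp
    linear_combination hcubic
  have h3' : a₃ = ((2 * d' * -κ' + d'' * -κ) + μ * k * -κ / J) / (d' ^ 2 + μ) := by
    field_simp
    linear_combination hcubic
  rw [h3'] at hspeed
  field_simp at hspeed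
  linear_combination hspeed


/-! ### Weighted jets and partial derivatives along coordinate lines -/

/-- The weighted-jet convention of `…CurvedTowerElimHeight`: `HasDerivAt f (d₁·(f′/d₁)) z`. -/
theorem hasDerivAt_weighted {f : ℝ → ℝ} {f' d₁ z : ℝ} (hf : HasDerivAt f f' z) (hd : d₁ ≠ 0) :
    HasDerivAt f (d₁ * (f' / d₁)) z :=
  hf.congr_deriv (by field_simp)

/-- Schwarz at a `C²` point: `∂₂(∂₁F) = ∂₁(∂₂F)` in `fderiv` form. -/
theorem fderiv_partial_swap {F : ℝ × ℝ → ℝ} {p : ℝ × ℝ} (hF : ContDiffAt ℝ 2 F p) :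
    fderiv ℝ (fun q => fderiv ℝ F q ((1 : ℝ), (0 : ℝ))) p ((0 : ℝ), (1 : ℝ)) =
      fderiv ℝ (fun q => fderiv ℝ F q ((0 : ℝ), (1 : ℝ))) p ((1 : ℝ), (0 : ℝ)) := by
  have hD : DifferentiableAt ℝ (fderiv ℝ F) p := (hF.fderiv_right (m := 1) le_rfl).differentiableAt (by simp)
  rw [fderiv_clm_apply hD (differentiableAt_const _), fderiv_clm_apply hD (differentiableAt_const _)]
  simp only [fderiv_fun_const, Pi.zero_apply, ContinuousLinearMap.comp_zero, zero_add, ContinuousLinearMap.flip_apply]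
  exact hF.isSymmSndFDerivAt (by simp only [minSmoothness_of_isRCLikeNormedField]; norm_num) _ _


/-! ### Jet packages: weighted height jets of a smooth profile, and the four jets of a smooth function on a product -/

/-- **Weighted height jets of a smooth profile.**  For `f` smooth on the open window `I` and a smooth weight `d₁ ≠ 0` there: the functions `f₁ = f′/d₁`, `f₂ = f₁′/d₁`, `f₃ = f₂′/d₁`
are linked by `HasDerivAt f (d₁ f₁) z`, `HasDerivAt f₁ (d₁ f₂) z`, `HasDerivAt f₂ (d₁ f₃) z` on `I` (the currency of `…CurvedTowerElimHeight`). -/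
theorem weighted_jets {I : Set ℝ} (hI : IsOpen I) {f d₁ : ℝ → ℝ} (hf : ContDiffOn ℝ ∞ f I) (hd₁ : ContDiffOn ℝ ∞ d₁ I) (hd0 : ∀ z ∈ I, d₁ z ≠ 0) :
    ∃ f₁ f₂ f₃ : ℝ → ℝ, (∀ z ∈ I, f₁ z = deriv f z / d₁ z) ∧ ContDiffOn ℝ ∞ f₁ I ∧
      (∀ z ∈ I, HasDerivAt f (d₁ z * f₁ z) z) ∧ (∀ z ∈ I, HasDerivAt f₁ (d₁ z * f₂ z) z) ∧ (∀ z ∈ I, HasDerivAt f₂ (d₁ z * f₃ z) z) := by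
  -- one step: `g ∈ C^∞(I)` ⇒ `g′/d₁ ∈ C^∞(I)` and the weighted link
  have step : ∀ {g : ℝ → ℝ}, ContDiffOn ℝ ∞ g I →
      ContDiffOn ℝ ∞ (fun z => deriv g z / d₁ z) I ∧ ∀ z ∈ I, HasDerivAt g (d₁ z * (deriv g z / d₁ z)) z := by
    intro g hg
    have hg' : ContDiffOn ℝ ∞ (deriv g) I := hg.deriv_of_isOpen hI (m := ∞) (by simp)
    refine ⟨hg'.div hd₁ hd0, fun z hz => ?_⟩
    have hdiff : DifferentiableAt ℝ g z := (hg.contDiffAt (hI.mem_nhds hz)).differentiableAt (by simp)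
    exact hasDerivAt_weighted hdiff.hasDerivAt (hd0 z hz)
  obtain ⟨h1c, h1d⟩ := step hf
  obtain ⟨h2c, h2d⟩ := step h1c
  obtain ⟨-, h3d⟩ := step h2c
  exact ⟨fun z => deriv f z / d₁ z, fun z => deriv (fun z => deriv f z / d₁ z) z / d₁ z,
    fun z => deriv (fun z => deriv (fun z => deriv f z / d₁ z) z / d₁ z) z / d₁ z, fun z _ => rfl, h1c, h1d, h2d, h3d⟩

/-- **The four jets of a smooth function on an open product `S × I`** in the weighted currency: with `F_s(s,z) = ∂₁F`, `F_m = ∂₂F/d₁`, `F_sm = ∂₂∂₁F/d₁`: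
`HasDerivAt (F(·,z)) F_s s`, `HasDerivAt (F(s,·)) (d₁ F_m) z`, `HasDerivAt (F_s(s,·)) (d₁ F_sm) z` and (Schwarz) `HasDerivAt (F_m(·,z)) F_sm s`. -/
theorem plane_jets {S I : Set ℝ} (hS : IsOpen S) (hI : IsOpen I) {F : ℝ × ℝ → ℝ} (hF : ContDiffOn ℝ ∞ F (S ×ˢ I)) {d₁ : ℝ → ℝ}
    (hd0 : ∀ z ∈ I, d₁ z ≠ 0) {s z : ℝ} (hs : s ∈ S) (hz : z ∈ I) :
    HasDerivAt (fun s' => F (s', z)) (fderiv ℝ F (s, z) ((1 : ℝ), (0 : ℝ))) s ∧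
    HasDerivAt (fun z' => F (s, z')) (d₁ z * (fderiv ℝ F (s, z) ((0 : ℝ), (1 : ℝ)) / d₁ z)) z ∧
    HasDerivAt (fun z' => fderiv ℝ F (s, z') ((1 : ℝ), (0 : ℝ)))
      (d₁ z * (fderiv ℝ (fun q => fderiv ℝ F q ((1 : ℝ), (0 : ℝ))) (s, z) ((0 : ℝ), (1 : ℝ)) / d₁ z)) z ∧
    HasDerivAt (fun s' => fderiv ℝ F (s', z) ((0 : ℝ), (1 : ℝ)) / d₁ z)
      (fderiv ℝ (fun q => fderiv ℝ F q ((1 : ℝ), (0 : ℝ))) (s, z) ((0 : ℝ), (1 : ℝ)) / d₁ z) s := by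
  have hp : (s, z) ∈ S ×ˢ I := ⟨hs, hz⟩
  have hFp : ContDiffAt ℝ ∞ F (s, z) := hF.contDiffAt ((hS.prod hI).mem_nhds hp)
  have hF2 : ContDiffAt ℝ 2 F (s, z) := hFp.of_le (by norm_cast)
  have hFd : DifferentiableAt ℝ F (s, z) := hFp.differentiableAt (by simp)
  refine ⟨hasDerivAt_slice_fst (p := (s, z)) hFd, ?_, ?_, ?_⟩
  · exact hasDerivAt_weighted (hasDerivAt_slice_snd (p := (s, z)) hFd) (hd0 z hz)
  · exact hasDerivAt_weighted (hasDerivAt_slice_snd (p := (s, z)) (differentiableAt_dirPartial hF2 _)) (hd0 z hz)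
  · have h := (hasDerivAt_slice_fst (p := (s, z)) (differentiableAt_dirPartial hF2 ((0 : ℝ), (1 : ℝ)))).div_const (d₁ z)
    rw [← fderiv_partial_swap hF2] at h
    exact h


/-! ### The kinematic sheet-speed hypothesis from criticality along a moving web point -/

/-- **`hkin` from criticality.**  Let `F : ℝ × E → ℝ` be `C²` near `(τ₁, P₀)`, `P : ℝ → E` a curve with `P τ₁ = P₀` and velocity `V•ν` at `τ₁`, and suppose the slice
`y ↦ F(τ, y)` is critical along `ν` at the moving point `P τ` for `τ` near `τ₁`.  Then the space–time Hessian of `F` kills `((1, V•ν), (0, ν))` — the hypothesis `hkin` of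
`…CurvedSheetSpeedLaw(Local).curved_sheet_speed_law(_on)` / `…RidgeWebDynamics.sheetSpeed_eq_fderiv_timeDeriv`. -/
theorem hkin_of_criticality {E : Type*} [NormedAddCommGroup E] [NormedSpace ℝ E] {F : ℝ × E → ℝ} {τ₁ : ℝ} {P₀ ν : E} {V : ℝ} {P : ℝ → E}
    (hF : ContDiffAt ℝ 2 F (τ₁, P₀)) (hP0 : P τ₁ = P₀) (hP : HasDerivAt P (V • ν) τ₁)
    (hcrit : ∀ᶠ τ in 𝓝 τ₁, fderiv ℝ (fun y => F (τ, y)) (P τ) ν = 0) :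
    fderiv ℝ (fderiv ℝ F) (τ₁, P₀) ((1 : ℝ), V • ν) ((0 : ℝ), ν) = 0 := by
  -- `F` is `C¹` near `(τ₁, P₀)`; `DF` is differentiable at `(τ₁, P₀)`
  have hF1 : ∀ᶠ q in 𝓝 ((τ₁, P₀) : ℝ × E), ContDiffAt ℝ 1 F q := by
    have h := hF.eventually (by simp)
    exact h.mono fun q hq => hq.of_le (by norm_num)
  have hDF : DifferentiableAt ℝ (fderiv ℝ F) (τ₁, P₀) := (hF.fderiv_right (m := 1) le_rfl).differentiableAt (by simp)
  -- the space–time curve `τ ↦ (τ, P τ)` and its velocity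
  have hcurve : HasDerivAt (fun τ : ℝ => ((τ, P τ) : ℝ × E)) ((1 : ℝ), V • ν) τ₁ := (hasDerivAt_id τ₁).prodMk hP
  have hcont : ContinuousAt (fun τ : ℝ => ((τ, P τ) : ℝ × E)) τ₁ := hcurve.continuousAt
  have hcurve0 : (fun τ : ℝ => ((τ, P τ) : ℝ × E)) τ₁ = (τ₁, P₀) := by simp [hP0]
  -- slice derivative = partial derivative along `(0, ν)`, near `τ₁`
  have hF1' : ∀ᶠ τ in 𝓝 τ₁, ContDiffAt ℝ 1 F (τ, P τ) := by
    have := hcont.eventually (by rw [hcurve0]; exact hF1)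
    exact this
  have hslice : ∀ᶠ τ in 𝓝 τ₁, fderiv ℝ F (τ, P τ) ((0 : ℝ), ν) = 0 := by
    filter_upwards [hF1', hcrit] with τ hτ hc
    have hd : DifferentiableAt ℝ F (τ, P τ) := hτ.differentiableAt (by simp)
    have hι : HasFDerivAt (fun y : E => ((τ, y) : ℝ × E)) (ContinuousLinearMap.inr ℝ ℝ E) (P τ) :=
      (hasFDerivAt_const (τ : ℝ) (P τ)).prodMk (hasFDerivAt_id (P τ))
    have hcomp := hd.hasFDerivAt.comp (P τ) hι
    have : fderiv ℝ (fun y => F (τ, y)) (P τ) ν = fderiv ℝ F (τ, P τ) ((0 : ℝ), ν) := by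
      rw [show (fun y => F (τ, y)) = F ∘ fun y : E => ((τ, y) : ℝ × E) from rfl, hcomp.fderiv]
      simp
    rw [← this]; exact hc
  -- the partial `Φ q = DF(q)[(0,ν)]` vanishes along the curve near `τ₁`, so its derivative along the curve is zero
  set Φ : ℝ × E → ℝ := fun q => fderiv ℝ F q ((0 : ℝ), ν) with hΦ
  have hΦd : DifferentiableAt ℝ Φ (τ₁, P₀) := hDF.clm_apply (differentiableAt_const _)
  have hcomp : HasDerivAt (fun τ => Φ (τ, P τ)) (fderiv ℝ Φ (τ₁, P₀) ((1 : ℝ), V • ν)) τ₁ := by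
    have hΦd' : DifferentiableAt ℝ Φ ((fun τ : ℝ => ((τ, P τ) : ℝ × E)) τ₁) := by rw [hcurve0]; exact hΦd
    have h := hΦd'.hasFDerivAt.comp_hasDerivAt τ₁ hcurve
    rw [hcurve0] at h
    exact h
  have hzero : HasDerivAt (fun τ => Φ (τ, P τ)) 0 τ₁ := by
    have hev : (fun τ => Φ (τ, P τ)) =ᶠ[𝓝 τ₁] fun _ => (0 : ℝ) := by
      filter_upwards [hslice] with τ hτ using hτ
    exact (hasDerivAt_const τ₁ (0 : ℝ)).congr_of_eventuallyEq hev
  have hval : fderiv ℝ Φ (τ₁, P₀) ((1 : ℝ), V • ν) = 0 := hcomp.unique hzero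
  rw [hΦ, fderiv_clm_apply hDF (differentiableAt_const _)] at hval
  simpa using hval

end Summit.NavierStokesRegularity.NavierStokesRegularity.Theorems.PoloidalWindowDoorLrcModEntireCurvedTowerSheetForm

end
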